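import Summits.Ventures.PercRepro.GenQShareTables
import Summits.Ventures.PercRepro.GenQCovering
import Summits.Ventures.PercRepro.GenQOpenLayersCoreSmall
import Summits.Ventures.PercRepro.GenQOpenLayersCoreFree

/-!
# PercRepro — THE `t = 2` WINDOW OF THE `(13, 11)` ROW ON THE CORE, IN THE KERNEL (night-4, gen 3; sheet §50)

The type-`2` balance `0 ≤ Jq M G 11 2` on every coloop-free rank-`11` flat with at most `20` points of a Core
matroid, by the two charging layers with the endpoint tables of level `11` (`GenQShareTables.lean`) and the covering
count (`GenQCovering.lean`).  With `k = #(G ∖ B₀)`, `k₃` points of circuit size `3` and the deficit `1/6`: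

* the uniform bounds (`3`-circuit singletons `≥ 1/180`, others `≥ 5/144`, pairs `≥ 1/72`; demand-free `11/30`,
  `11/42`, `11/180`) carry every `(k, k₃)` except `k = 4`, `k₃ ≥ 2` (`charge_arith_eleven`);
* `k = 4`: `k₃ = 4` is impossible (`8 < 11` covered points, `card_le_sum_card_fc`); with `k₃ = 3` the fourth circuit
  has `≥ 6` points and charges `≥ 41/504`: `3/180 + 41/504 + 6/72 = 0.181`; with `k₃ = 2` the two other circuits have
  `≥ 9` points together, so one has `≥ 5` (`≥ 7/120`) and the other `≥ 4` (`≥ 5/144`): `2/180 + 7/120 + 5/144 + 6/72 =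
  0.1875` (`charge_ge_of_bounds_fn`).

Main statements: `jq_two_nonneg_of_core_eleven`, `ThirteenElevenResidueCoreFree`,
`openLayersCoreFree_eleven_of_residue`, `rls_thirteen_eleven_of_residue`.
-/

namespace PercRepro.GenQ

open Finset ThmH PerFlat SixFour ThmN NightThree

variable {α : Type*} [DecidableEq α] {M : Matroid α} [M.Finite]

/-! ## The charge of a demanding basis is at least `1/6` -/

/-- The arithmetic of the two layers at `q = 11` for every `(k, k₃)` with `k ∈ [2, 9]` except `k = 4`, `k₃ ≥ 2`. -/
theorem charge_arith_eleven (k k₃ : ℕ) (hk : 2 ≤ k) (hk9 : k ≤ 9) (hk₃ : k₃ ≤ k) (hne : ¬ (k = 4 ∧ 2 ≤ k₃))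
    (d₁ d₂ : ℚ) (hd₁0 : 0 ≤ d₁) (hd₁1 : d₁ ≤ 1) (hd₂0 : 0 ≤ d₂) (hd₂1 : d₂ ≤ 1) (hd₁ : k ≤ 2 → d₁ = 0)
    (hd₂ : k ≤ 3 → d₂ = 0) :
    1 / 6 ≤ (k₃ : ℚ) * (11 / 30 - (11 / 30 - 1 / 180) * d₁) +
      ((k - k₃ : ℕ) : ℚ) * (11 / 42 - (11 / 42 - 5 / 144) * d₁) +
      ((k.choose 2 : ℕ) : ℚ) * (11 / 180 - (11 / 180 - 1 / 72) * d₂) := by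
  interval_cases k <;> interval_cases k₃ <;> norm_num [Nat.choose] at hd₁ hd₂ ⊢ <;>
    first | (norm_num at hne; done) | (subst hd₁; subst hd₂; norm_num) | (subst hd₂; linarith) | linarith

/-- **Every basis `B₀` of a coloop-free `G` with `2 ≤ #(G ∖ B₀) ≤ 9` is charged at least `1/6`** at `q = 11`
(lines `≤ 3` points). -/
theorem thirteenEleven_charge_ge (hs : Simple M) (hline : ∀ L ∈ flatsQ M 2, L.card ≤ 3) {G B₀ : Finset α}
    (hG : G ⊆ gr M) (hrG : M.eRk (G : Set α) = ((11 : ℕ) : ℕ∞)) (hB : B₀ ∈ basesOf M G 11) (hfree : mTr M G = 0)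
    (hk : 2 ≤ (G \ B₀).card) (hk9 : (G \ B₀).card ≤ 9) : 1 / 6 ≤ charge M G 11 B₀ := by
  have hne : B₀.Nonempty := Finset.card_pos.1 (by rw [(mem_basesOf.1 hB).2.2]; norm_num)
  have hc3 : ∀ x ∈ G \ B₀, 3 ≤ (fc M x B₀).card := fun x hx =>
    three_le_card_fc hs ((mem_basesOf.1 hB).1.trans hG) (hG (Finset.mem_sdiff.1 hx).1) (indep_of_mem_basesOf hB)
      (mem_closure_of_mem_basesOf hG hrG hB (Finset.mem_sdiff.1 hx).1) (Finset.mem_sdiff.1 hx).2 hne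
  have hc12 : ∀ x ∈ G \ B₀, (fc M x B₀).card ≤ 12 := fun x _ => by
    have := card_fc_le (M := M) x B₀
    rw [(mem_basesOf.1 hB).2.2] at this
    omega
  have hU5 : ∀ P ∈ (G \ B₀).powersetCard 2, ∀ x ∈ P, ∀ y ∈ P, x ≠ y → 5 ≤ (fc M x B₀ ∪ fc M y B₀).card := by
    intro P hP x hx y hy hxy
    have hPsub := (Finset.mem_powersetCard.1 hP).1
    exact five_le_card_union_fc hs hline hG hrG hB (by norm_num) (Finset.mem_sdiff.1 (hPsub hx)).1
      (Finset.mem_sdiff.1 (hPsub hx)).2 (Finset.mem_sdiff.1 (hPsub hy)).1 (Finset.mem_sdiff.1 (hPsub hy)).2 hxy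
  -- the tables of level `8`
  have t3 := fun x (hx : x ∈ G \ B₀) (h : (fc M x B₀).card = 3) => single_bound_of_table hs hG hrG hB (by norm_num) hx
    (c₀ := 3) (c₁ := 3) (by omega) (by omega) (σ₀ := 11 / 30) (σ₁ := 1 / 180) (by norm_num)
    (by intro c h0 h1; interval_cases c; norm_num) (by intro c h0 h1; interval_cases c; norm_num)
  have t4 := fun x (hx : x ∈ G \ B₀) (h : (fc M x B₀).card ≠ 3) => single_bound_of_table hs hG hrG hB (by norm_num) hx
    (c₀ := 4) (c₁ := 12) (by have := hc3 x hx; omega) (hc12 x hx) (σ₀ := 11 / 42) (σ₁ := 5 / 144)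
    (by norm_num)
    (by intro c h0 h1; interval_cases c <;> norm_num) (by intro c h0 h1; interval_cases c <;> norm_num)
  have t5 := fun x (hx : x ∈ G \ B₀) (h : 5 ≤ (fc M x B₀).card) => single_bound_of_table hs hG hrG hB (by norm_num) hx
    (c₀ := 5) (c₁ := 12) h (hc12 x hx) (σ₀ := 11 / 42) (σ₁ := 7 / 120) (by norm_num)
    (by intro c h0 h1; interval_cases c <;> norm_num) (by intro c h0 h1; interval_cases c <;> norm_num)
  have t6 := fun x (hx : x ∈ G \ B₀) (h : 6 ≤ (fc M x B₀).card) => single_bound_of_table hs hG hrG hB (by norm_num) hx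
    (c₀ := 6) (c₁ := 12) h (hc12 x hx) (σ₀ := 11 / 42) (σ₁ := 41 / 504) (by norm_num)
    (by intro c h0 h1; interval_cases c <;> norm_num) (by intro c h0 h1; interval_cases c <;> norm_num)
  have tp := fun P (hP : P ∈ (G \ B₀).powersetCard 2) => pair_bound_of_table hs hG hrG hB (by norm_num) hP (u₀ := 5)
    (by norm_num) (hU5 P hP) (τ₀ := 11 / 180) (τ₁ := 1 / 72) (by norm_num)
    (by intro u h0 h1; interval_cases u <;> norm_num [Nat.choose])
    (by intro u h0 h1; interval_cases u <;> norm_num [Nat.choose])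
  set K := G \ B₀ with hK
  set K₃ := K.filter (fun x => (fc M x B₀).card = 3) with hK₃
  set D₁ : ℚ := if K.card ≤ 2 then 0 else 1 with hD₁
  set D₂ : ℚ := if K.card ≤ 3 then 0 else 1 with hD₂
  have hK₃K : K₃ ⊆ K := Finset.filter_subset _ _
  have hK₃le := Finset.card_le_card hK₃K
  by_cases hspecial : K.card = 4 ∧ 2 ≤ K₃.card
  · obtain ⟨hk4, hk₃2⟩ := hspecial
    have hD : D₁ = 1 := by rw [hD₁, if_neg (by omega)]
    have hD' : D₂ = 1 := by rw [hD₂, if_neg (by omega)]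
    have hS := card_le_sum_card_fc hG hrG hB hfree
    rw [← hK] at hS
    have hsum₃ : ∑ x ∈ K₃, ((fc M x B₀).card - 1) = 2 * K₃.card := by
      have : ∑ x ∈ K₃, ((fc M x B₀).card - 1) = ∑ _x ∈ K₃, 2 := by
        apply Finset.sum_congr rfl
        intro x hx
        rw [hK₃, Finset.mem_filter] at hx
        omega
      rw [this, Finset.sum_const, smul_eq_mul, mul_comm]
    rw [← Finset.sum_sdiff hK₃K, hsum₃] at hS
    by_cases hk₃4 : K₃.card = 4
    · -- four `3`-circuits cannot cover eleven basis points
      exfalso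
      have hK₃eq : K₃ = K := Finset.eq_of_subset_of_card_le hK₃K (by omega)
      rw [hK₃eq, Finset.sdiff_self, Finset.sum_empty, hk4] at hS
      omega
    by_cases hk₃3 : K₃.card = 3
    · -- the fourth circuit `C_z` has `≥ 6` points
      have hone : (K \ K₃).card = 1 := by rw [Finset.card_sdiff_of_subset hK₃K]; omega
      obtain ⟨z, hz⟩ := Finset.card_eq_one.1 hone
      have hzK : z ∈ K := (Finset.mem_sdiff.1 (by rw [hz]; exact Finset.mem_singleton_self z)).1
      have honly : ∀ x ∈ K, (fc M x B₀).card ≠ 3 → x = z := by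
        intro x hx h3
        have : x ∈ K \ K₃ := Finset.mem_sdiff.2 ⟨hx, fun h => h3 (Finset.mem_filter.1 h).2⟩
        rw [hz, Finset.mem_singleton] at this
        exact this
      rw [hz, Finset.sum_singleton, hk₃3] at hS
      have hz6 : 6 ≤ (fc M z B₀).card := by omega
      have h := charge_ge_of_bounds hs hG hrG hB (by norm_num) (11 / 30 - (11 / 30 - 1 / 180) * D₁)
        (11 / 42 - (11 / 42 - 41 / 504) * D₁) (11 / 180 - (11 / 180 - 1 / 72) * D₂)
        (fun x hx h3 => t3 x hx h3)
        (fun x hx h3 => t6 x hx (by rw [honly x hx h3]; exact hz6))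
        (fun P hP => tp P hP)
      rw [hk4, hk₃3, hD, hD'] at h
      norm_num [Nat.choose] at h ⊢
      linarith
    · -- `k₃ = 2`: the two other circuits have `≥ 9` points together
      have hk₃2' : K₃.card = 2 := by omega
      have htwo : (K \ K₃).card = 2 := by rw [Finset.card_sdiff_of_subset hK₃K]; omega
      obtain ⟨z, z', hzz', hzz'eq⟩ := Finset.card_eq_two.1 htwo
      rw [hzz'eq, Finset.sum_pair hzz', hk₃2'] at hS
      have hzK : z ∈ K \ K₃ := by rw [hzz'eq]; exact Finset.mem_insert_self z {z'}
      have hz'K : z' ∈ K \ K₃ := by rw [hzz'eq]; exact Finset.mem_insert_of_mem (Finset.mem_singleton_self z')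
      -- per-element singleton bounds
      set σ : α → ℚ := fun x => if (fc M x B₀).card = 3 then 1 / 180 else if 5 ≤ (fc M x B₀).card then 7 / 120
        else 5 / 144 with hσ
      have hσle : ∀ x ∈ K, σ x ≤ wTwo M G (insert x B₀) 11 / nb M G (insert x B₀) 11 := by
        intro x hx
        rw [hσ]
        simp only
        split_ifs with h3 h5
        · have := t3 x hx h3
          rw [hD] at this
          linarith
        · have := t5 x hx h5
          rw [hD] at this
          linarith
        · have := t4 x hx h3
          rw [hD] at this
          linarith
      have h := charge_ge_of_bounds_fn hs hG hrG hB (by norm_num) σ (fun _ => 11 / 180 - (11 / 180 - 1 / 72) * D₂)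
        hσle (fun P hP => tp P hP)
      rw [← hK, ← Finset.sum_sdiff hK₃K, hzz'eq, Finset.sum_pair hzz', Finset.sum_const,
        Finset.card_powersetCard, hk4, nsmul_eq_mul] at h
      have hσ₃ : ∀ x ∈ K₃, σ x = 1 / 180 := by
        intro x hx
        rw [hK₃, Finset.mem_filter] at hx
        rw [hσ]
        simp only
        rw [if_pos hx.2]
      rw [Finset.sum_congr rfl hσ₃, Finset.sum_const, nsmul_eq_mul, hk₃2'] at h
      -- `σ z + σ z' ≥ 7/120 + 5/144`: one of them has `≥ 5` points, both `≥ 4`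
      have hz3 : (fc M z B₀).card ≠ 3 := fun h =>
        (Finset.mem_sdiff.1 hzK).2 (Finset.mem_filter.2 ⟨(Finset.mem_sdiff.1 hzK).1, h⟩)
      have hz'3 : (fc M z' B₀).card ≠ 3 := fun h =>
        (Finset.mem_sdiff.1 hz'K).2 (Finset.mem_filter.2 ⟨(Finset.mem_sdiff.1 hz'K).1, h⟩)
      have hσz : σ z + σ z' ≥ 7 / 120 + 5 / 144 := by
        rw [hσ]
        simp only
        rw [if_neg hz3, if_neg hz'3]
        split_ifs with h5 h5' h5'
        · norm_num
        · norm_num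
        · norm_num
        · exfalso
          push Not at h5 h5'
          omega
      rw [hD'] at h
      norm_num [Nat.choose] at h hσz ⊢
      linarith
  · have h := charge_ge_of_bounds hs hG hrG hB (by norm_num) (11 / 30 - (11 / 30 - 1 / 180) * D₁)
      (11 / 42 - (11 / 42 - 5 / 144) * D₁) (11 / 180 - (11 / 180 - 1 / 72) * D₂) t3 t4 tp
    have harith := charge_arith_eleven K.card K₃.card hk hk9 hK₃le hspecial D₁ D₂
      (by rw [hD₁]; split_ifs <;> norm_num) (by rw [hD₁]; split_ifs <;> norm_num)
      (by rw [hD₂]; split_ifs <;> norm_num) (by rw [hD₂]; split_ifs <;> norm_num)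
      (fun h2 => by rw [hD₁, if_pos h2]) (fun h3 => by rw [hD₂, if_pos h3])
    linarith

/-! ## The `t = 2` window of `(13, 11)` -/

/-- **The type-`2` balance on every coloop-free rank-`11` flat with at most `20` points when lines have `≤ 3`
points.** -/
theorem jq_two_nonneg_of_lines_eleven (hs : Simple M) (hline : ∀ L ∈ flatsQ M 2, L.card ≤ 3) {G : Finset α}
    (hG : G ∈ flatsQ M 11) (hfree : mTr M G = 0) (hcard : G.card ≤ 20) : 0 ≤ Jq M G 11 2 := by
  have hGg : G ⊆ gr M := (mem_flatsQ.1 hG).1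
  have hrG : M.eRk (G : Set α) = ((11 : ℕ) : ℕ∞) := (mem_flatsQ.1 hG).2.2
  apply Jq_two_nonneg_of_charge
  intro B₀ hB
  obtain ⟨hBG, hr, hc⟩ := mem_basesOf.1 hB
  have hkc : (G \ B₀).card = G.card - 11 := by rw [Finset.card_sdiff_of_subset hBG, hc]
  have hw : -(1 / 6 : ℚ) ≤ wTwo M G B₀ 11 := by
    unfold wTwo wInf
    have hm : mTr M B₀ ≤ 11 := mTr_le_of_eRk_eq (hBG.trans hGg) hr
    have hm' : (mTr M B₀ : ℚ) ≤ 11 := by exact_mod_cast hm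
    have hwinf : (1 : ℚ) / 12 ≤ 1 / (1 + (mTr M B₀ : ℚ)) := one_div_le_one_div_of_le (by positivity) (by linarith)
    have hd := dem_le_one (M := M) G B₀ 2
    push_cast
    nlinarith
  by_cases hk : (G \ B₀).card ≤ 1
  · have hd0 : dem M G 2 B₀ = 0 := dem_two_eq_zero_of_card_le_one hk
    have hw0 : 0 ≤ wTwo M G B₀ 11 := by
      unfold wTwo
      rw [hd0]
      have := wInf_pos (M := M) B₀
      push_cast
      nlinarith
    have hch : 0 ≤ charge M G 11 B₀ := by
      have := charge_ge_sum_of_subset (q := 11) hs hGg (by norm_num) B₀ (T := ∅) (Finset.empty_subset _)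
      rwa [Finset.sum_empty] at this
    linarith
  · have hch := thirteenEleven_charge_ge hs hline hGg hrG hB hfree (by omega) (by omega)
    linarith

/-- **THE `t = 2` WINDOW OF THE `(13, 11)` ROW ON THE CORE**: on every Core matroid, every coloop-free rank-`11`
flat with at most `20` points satisfies the type-`2` balance `0 ≤ Jq M G 11 2`. -/
theorem jq_two_nonneg_of_core_eleven {γ : Type} [DecidableEq γ] {M : Matroid γ} [M.Finite] {p : ℕ} (hc : Core M p)
    {G : Finset γ} (hG : G ∈ flatsQ M 11) (hfree : mTr M G = 0) (hcard : G.card ≤ 20) : 0 ≤ Jq M G 11 2 :=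
  jq_two_nonneg_of_lines_eleven (simple_of_core hc) (fun _ hL => card_le_three_of_line_of_core hc hL) hG hfree
    hcard

/-- **The residue of the row `(13, 11)` at level `11`** on the coloop-free flats: the type-`1` balance when
`13 ≤ #G ≤ 19` and the type-`3 … 10` balances — `OpenLayersCoreFree 11` without its type-`2` clause. -/
def ThirteenElevenResidueCoreFree : Prop :=
  ∀ {β : Type} [DecidableEq β] (M : Matroid β) [M.Finite] (G : Finset β), Core M 13 → G ∈ flatsQ M 11 →
    mTr M G = 0 → (13 ≤ G.card → G.card ≤ 19 → 0 ≤ Jq M G 11 1) ∧ (∀ t, 3 ≤ t → t ≤ 10 → 0 ≤ Jq M G 11 t)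

/-- **`OpenLayersCoreFree 11` from the residue**: the type-`2` window `(g − 11)(g − 8) < 120`, i.e. `g ≤ 20`, is the
kernel theorem `jq_two_nonneg_of_core_eleven`; the type-`1` window `(g − 11)·14 + 1 < 121` is `g ≤ 19`. -/
theorem openLayersCoreFree_eleven_of_residue (h : ThirteenElevenResidueCoreFree) : OpenLayersCoreFree 11 := by
  intro β _ M _ G hc hG _ hfree
  obtain ⟨h1, h3⟩ := h M G hc hG hfree
  refine ⟨fun _ h13 hwin => h1 h13 (by norm_num at hwin; omega), fun hwin => ?_,
    fun t ht3 ht => h3 t ht3 (by omega)⟩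
  apply jq_two_nonneg_of_core_eleven hc hG hfree
  by_contra hg
  push Not at hg
  have h10 : 10 ≤ G.card - 11 := by omega
  have h13 : 13 ≤ G.card - 11 + 3 := by omega
  have := Nat.mul_le_mul h10 h13
  omega

/-- **C-025 at `(13, 11)` on every finite matroid** from the Core-typed layers of levels `5 … 10`, the level-`10`
trace sums and the `(13, 11)` residue on coloop-free flats. -/
theorem rls_thirteen_eleven_of_residue {α : Type} [DecidableEq α] (h5 : OpenLayersCore 5) (h6 : OpenLayersCore 6)
    (h7 : OpenLayersCore 7) (h8 : OpenLayersCore 8) (h9 : OpenLayersCore 9) (h10 : OpenLayersCore 10)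
    (htr : TraceSumsCore 10) (h11 : ThirteenElevenResidueCoreFree) (M : Matroid α) [M.Finite] : RLS M 13 11 := by
  refine rls_succ_succ_of_openLayersCore 11 (by norm_num) ?_ M
  intro q' hq'5 hq'
  rcases (show q' = 5 ∨ q' = 6 ∨ q' = 7 ∨ q' = 8 ∨ q' = 9 ∨ q' = 10 ∨ q' = 11 by omega) with
    rfl | rfl | rfl | rfl | rfl | rfl | rfl
  · exact h5
  · exact h6
  · exact h7
  · exact h8
  · exact h9
  · exact h10
  · exact openLayersCore_succ_of_free (by norm_num) htr (openLayersCoreFree_eleven_of_residue h11)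

end PercRepro.GenQ
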